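import Literature.Probability.Percolation.FiveMarkedLoopStubs
import Literature.Probability.Percolation.FiveMarkedS0HexBall1
import HarnessLib

/-!
# The five-marked loop lemma decided on the smallest five-marked domain `hexBall1Five` (the «LOOP5 rung»)

Topic `Literature/Probability/Percolation` (site percolation on `𝕋`; the five-point interface layer of Khristoforov–Smirnov
2021 in the Bollobás–Riordan vocabulary of the tree: `FiveMarkedLoops.lean` (the objects `Bicol`, `IStep`, `MatchA`,
`MatchB`, `FiveMarkedLoopLemmaFin`), `FiveMarkedLoopStubs.lean`/`FiveMarkedLoopLemma.lean` (the general-domain proof),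
`FiveMarkedS0HexBall1.lean` (the tabulation `cornerT`/`stretchT`/`BicolS`/`IStepS` on `hexBall1Five`)). Sources:
M. Khristoforov, S. Smirnov, *Percolation and O(1) loop model*, arXiv:2111.15612 (2021), §1.2, Lemma 2 (arXiv p. 4: for four
boundary disorders exactly two link patterns occur and the crossing event is the link-pattern event under the
colouring ↔ loop-configuration bijection); B. Bollobás, O. Riordan, *Percolation* (CUP 2006), Ch. 7, §7.2.2 and Lemma 5,
pp. 168–171 (marked discrete domains, arcs, the black/white interface).

THIS FILE is the INDEPENDENT DECIDED INSTANCE of the general theorem `FivePoint.fiveMarkedLoopLemma_holds`: on the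
7-site domain `hexBall1Five` (`TriHexBallDomain.lean`) the finite form `FiveMarkedLoopLemmaFin hexBall1Five` — for every
colouring `S ⊆ triBall 1` and every reference corner `r`, exactly one of the link patterns `A = [y_{r+1} ↔ y_{r+2}]`,
`B = [y_{r+1} ↔ y_{r+4}]` occurs, `B` iff an open crossing `A_{r+1} ↔ A_{r+3}`, `A` iff a closed crossing
`A_{r+2} → A_{r+4}` or `A_{r+2} → A_r` — is DECIDED by the kernel on all `2⁷ × 5 = 640` instances (five
`decide +kernel`, standard axioms, no `native_decide`) through a list-structural checker: §R1 the finite geometry as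
literal tables (the 24 faces of `H` meeting the ball, the 60 ordered bicolourable face adjacencies with the data `Bicol`
reads, the 24 site adjacencies, the arcs), §R3 the tables PROVED equal to the definitions by `decide`, §R2 index-level
breadth-first closures whose closedness is re-checked inside the checker, §R5–§R9 soundness (`bicolE_iff`,
`closF_reach`, `closF_closed`, `linked_iff_closF`, `cross_iff`), §R10 `fiveMarkedLoopLemmaFin_of_rungCheck`, §R11 the
five kernel evaluations. It is the lane's definitional sanity check of the interface layer against an independent
enumeration (640/640 instances from the definitions, three codes).

Status in print (lane «pcv-sawmu» wording, lit-2 g12): Khristoforov–Smirnov 2021 Lemma 2 [§1.2, arXiv p. 4]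
(= Bollobás–Riordan Ch. 7 Lemma 5's colouring/loop bijection), per corner of the five-marked domain `hexBall1Five`,
verified by decision on all `2⁷` colourings × `5` corners; first kernel witness; computational instance (C-class), no
novelty claimed; the general-domain lemma is `FivePoint.fiveMarkedLoopLemma_holds`.
-/

noncomputable section

open Finset

namespace Literature.Probability.Percolation.FivePoint.Rung

open Literature.Probability.LatticeModels Literature.Probability.Percolation.FivePoint.S0

/-! ### R1. Tables -/

/-- A bicolourable face adjacency of the ball domain with the data `Bicol` reads: face indices `i → j` (into `faceL`),
the common `𝕋`-edge `{u, v}`, whether `u`, `v` lie in `triBall 1`, their bit positions `a`, `b` (into `ballV`), and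
the stretch indices of the darts `(u, v)` and `(v, u)`. [cite: BollobasRiordan2006, Ch. 7 §7.2.2 pp. 168–171] -/
structure FEdge where
  /-- source face index [cite: BollobasRiordan2006, Ch. 7 §7.2.2 pp. 168–171] -/
  i : ℕ
  /-- target face index [cite: BollobasRiordan2006, Ch. 7 §7.2.2 pp. 168–171] -/
  j : ℕ
  /-- first endpoint of the common edge [cite: BollobasRiordan2006, Ch. 7 §7.2.2 pp. 168–171] -/
  u : Site 2
  /-- second endpoint of the common edge [cite: BollobasRiordan2006, Ch. 7 §7.2.2 pp. 168–171] -/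
  v : Site 2
  /-- `u ∈ triBall 1` [cite: BollobasRiordan2006, Ch. 7 §7.2.2 pp. 168–171] -/
  inU : Bool
  /-- `v ∈ triBall 1` [cite: BollobasRiordan2006, Ch. 7 §7.2.2 pp. 168–171] -/
  inV : Bool
  /-- bit position of `u` (junk if `u ∉ triBall 1`) [cite: BollobasRiordan2006, Ch. 7 §7.2.2 pp. 168–171] -/
  a : ℕ
  /-- bit position of `v` (junk if `v ∉ triBall 1`) [cite: BollobasRiordan2006, Ch. 7 §7.2.2 pp. 168–171] -/
  b : ℕ
  /-- stretch index of the dart `(u, v)` [cite: BollobasRiordan2006, Ch. 7 §7.2.2 pp. 168–171] -/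
  tuv : Fin 5
  /-- stretch index of the dart `(v, u)` [cite: BollobasRiordan2006, Ch. 7 §7.2.2 pp. 168–171] -/
  tvu : Fin 5
  deriving DecidableEq

/-- The seven sites of `triBall 1`, indexed by bit position. [cite: BollobasRiordan2006, Ch. 7 §7.2.2 pp. 168–171] -/
def ballV : List (Site 2) := [![0, 0], ![1, 0], ![0, 1], ![-1, 1], ![-1, 0], ![0, -1], ![1, -1]]

/-- Site at bit position `a` (junk `0` beyond `6`). [cite: BollobasRiordan2006, Ch. 7 §7.2.2 pp. 168–171] -/
def ballAt (a : ℕ) : Site 2 := ballV.getD a 0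

/-- The 24 faces of `𝕋` with a vertex in `triBall 1` (`= S0.U1`, `faceL_toFinset`). [cite: BollobasRiordan2006, Ch. 7 §7.2.2 pp. 168–171] -/
def faceL : List HexVertex :=
  [(![-2, -1], 1), (![-2, 0], 0), (![-2, 0], 1), (![-2, 1], 0),
   (![-2, 1], 1), (![-1, -2], 1), (![-1, -1], 0), (![-1, -1], 1),
   (![-1, 0], 0), (![-1, 0], 1), (![-1, 1], 0), (![-1, 1], 1),
   (![0, -2], 0), (![0, -2], 1), (![0, -1], 0), (![0, -1], 1),
   (![0, 0], 0), (![0, 0], 1), (![0, 1], 0), (![1, -2], 0),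
   (![1, -2], 1), (![1, -1], 0), (![1, -1], 1), (![1, 0], 0)]

/-- Indices in `faceL` of the five corner faces `S0.cornerT`. [cite: BollobasRiordan2006, Ch. 7 §7.2.2 pp. 168–171] -/
def cornerIdx : Fin 5 → ℕ := ![22, 18, 4, 1, 5]

/-- The 60 ordered pairs of `hexGraph`-adjacent faces of `faceL` whose common `𝕋`-edge `{u, v}` has an
endpoint in `triBall 1`, with the precomputed data `Bicol` reads: membership of `u`, `v` in the ball, their bit
positions, and the stretch indices of the darts `(u, v)`, `(v, u)` (verified against the definitions in `edgeTab_ok`). [cite: BollobasRiordan2006, Ch. 7 §7.2.2 pp. 168–171] -/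
def edgeTab : List FEdge :=
  [⟨0, 1, ![-2, 0], ![-1, 0], false, true, 0, 4, 0, 3⟩,
   ⟨0, 6, ![-1, -1], ![-1, 0], false, true, 0, 4, 0, 3⟩,
   ⟨1, 0, ![-2, 0], ![-1, 0], false, true, 0, 4, 0, 3⟩,
   ⟨1, 2, ![-2, 1], ![-1, 0], false, true, 0, 4, 0, 2⟩,
   ⟨2, 1, ![-2, 1], ![-1, 0], false, true, 0, 4, 0, 2⟩,
   ⟨2, 3, ![-2, 1], ![-1, 1], false, true, 0, 3, 0, 2⟩,
   ⟨2, 8, ![-1, 0], ![-1, 1], true, true, 4, 3, 0, 0⟩,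
   ⟨3, 2, ![-2, 1], ![-1, 1], false, true, 0, 3, 0, 2⟩,
   ⟨3, 4, ![-2, 2], ![-1, 1], false, true, 0, 3, 0, 2⟩,
   ⟨4, 3, ![-2, 2], ![-1, 1], false, true, 0, 3, 0, 2⟩,
   ⟨4, 10, ![-1, 1], ![-1, 2], true, false, 3, 0, 1, 0⟩,
   ⟨5, 6, ![-1, -1], ![0, -1], false, true, 0, 5, 0, 3⟩,
   ⟨5, 12, ![0, -2], ![0, -1], false, true, 0, 5, 0, 4⟩,
   ⟨6, 0, ![-1, -1], ![-1, 0], false, true, 0, 4, 0, 3⟩,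
   ⟨6, 5, ![-1, -1], ![0, -1], false, true, 0, 5, 0, 3⟩,
   ⟨6, 7, ![-1, 0], ![0, -1], true, true, 4, 5, 0, 0⟩,
   ⟨7, 6, ![-1, 0], ![0, -1], true, true, 4, 5, 0, 0⟩,
   ⟨7, 8, ![-1, 0], ![0, 0], true, true, 4, 0, 0, 0⟩,
   ⟨7, 14, ![0, -1], ![0, 0], true, true, 5, 0, 0, 0⟩,
   ⟨8, 2, ![-1, 0], ![-1, 1], true, true, 4, 3, 0, 0⟩,
   ⟨8, 7, ![-1, 0], ![0, 0], true, true, 4, 0, 0, 0⟩,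
   ⟨8, 9, ![-1, 1], ![0, 0], true, true, 3, 0, 0, 0⟩,
   ⟨9, 8, ![-1, 1], ![0, 0], true, true, 3, 0, 0, 0⟩,
   ⟨9, 10, ![-1, 1], ![0, 1], true, true, 3, 2, 0, 0⟩,
   ⟨9, 16, ![0, 0], ![0, 1], true, true, 0, 2, 0, 0⟩,
   ⟨10, 4, ![-1, 1], ![-1, 2], true, false, 3, 0, 1, 0⟩,
   ⟨10, 9, ![-1, 1], ![0, 1], true, true, 3, 2, 0, 0⟩,
   ⟨10, 11, ![-1, 2], ![0, 1], false, true, 0, 2, 0, 1⟩,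
   ⟨11, 10, ![-1, 2], ![0, 1], false, true, 0, 2, 0, 1⟩,
   ⟨11, 18, ![0, 1], ![0, 2], true, false, 2, 0, 1, 0⟩,
   ⟨12, 5, ![0, -2], ![0, -1], false, true, 0, 5, 0, 4⟩,
   ⟨12, 13, ![0, -1], ![1, -2], true, false, 5, 0, 4, 0⟩,
   ⟨13, 12, ![0, -1], ![1, -2], true, false, 5, 0, 4, 0⟩,
   ⟨13, 14, ![0, -1], ![1, -1], true, true, 5, 6, 0, 0⟩,
   ⟨13, 19, ![1, -2], ![1, -1], false, true, 0, 6, 0, 4⟩,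
   ⟨14, 7, ![0, -1], ![0, 0], true, true, 5, 0, 0, 0⟩,
   ⟨14, 13, ![0, -1], ![1, -1], true, true, 5, 6, 0, 0⟩,
   ⟨14, 15, ![0, 0], ![1, -1], true, true, 0, 6, 0, 0⟩,
   ⟨15, 14, ![0, 0], ![1, -1], true, true, 0, 6, 0, 0⟩,
   ⟨15, 16, ![0, 0], ![1, 0], true, true, 0, 1, 0, 0⟩,
   ⟨15, 21, ![1, -1], ![1, 0], true, true, 6, 1, 0, 0⟩,
   ⟨16, 9, ![0, 0], ![0, 1], true, true, 0, 2, 0, 0⟩,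
   ⟨16, 15, ![0, 0], ![1, 0], true, true, 0, 1, 0, 0⟩,
   ⟨16, 17, ![0, 1], ![1, 0], true, true, 2, 1, 0, 0⟩,
   ⟨17, 16, ![0, 1], ![1, 0], true, true, 2, 1, 0, 0⟩,
   ⟨17, 18, ![0, 1], ![1, 1], true, false, 2, 0, 0, 0⟩,
   ⟨17, 23, ![1, 0], ![1, 1], true, false, 1, 0, 0, 0⟩,
   ⟨18, 11, ![0, 1], ![0, 2], true, false, 2, 0, 1, 0⟩,
   ⟨18, 17, ![0, 1], ![1, 1], true, false, 2, 0, 0, 0⟩,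
   ⟨19, 13, ![1, -2], ![1, -1], false, true, 0, 6, 0, 4⟩,
   ⟨19, 20, ![1, -1], ![2, -2], true, false, 6, 0, 4, 0⟩,
   ⟨20, 19, ![1, -1], ![2, -2], true, false, 6, 0, 4, 0⟩,
   ⟨20, 21, ![1, -1], ![2, -1], true, false, 6, 0, 4, 0⟩,
   ⟨21, 15, ![1, -1], ![1, 0], true, true, 6, 1, 0, 0⟩,
   ⟨21, 20, ![1, -1], ![2, -1], true, false, 6, 0, 4, 0⟩,
   ⟨21, 22, ![1, 0], ![2, -1], true, false, 1, 0, 4, 0⟩,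
   ⟨22, 21, ![1, 0], ![2, -1], true, false, 1, 0, 4, 0⟩,
   ⟨22, 23, ![1, 0], ![2, 0], true, false, 1, 0, 0, 0⟩,
   ⟨23, 17, ![1, 0], ![1, 1], true, false, 1, 0, 0, 0⟩,
   ⟨23, 22, ![1, 0], ![2, 0], true, false, 1, 0, 0, 0⟩]

/-- The tabulated adjacencies grouped by source face index (`adjL[x]` = the entries of `edgeTab` out of `x`;
`adjL_ok`), so that the closures touch only the edges at the popped face. [cite: BollobasRiordan2006, Ch. 7 §7.2.2 pp. 168–171] -/
def adjL : List (List FEdge) :=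
  [[⟨0, 1, ![-2, 0], ![-1, 0], false, true, 0, 4, 0, 3⟩, ⟨0, 6, ![-1, -1], ![-1, 0], false, true, 0, 4, 0, 3⟩],
   [⟨1, 0, ![-2, 0], ![-1, 0], false, true, 0, 4, 0, 3⟩, ⟨1, 2, ![-2, 1], ![-1, 0], false, true, 0, 4, 0, 2⟩],
   [⟨2, 1, ![-2, 1], ![-1, 0], false, true, 0, 4, 0, 2⟩, ⟨2, 3, ![-2, 1], ![-1, 1], false, true, 0, 3, 0, 2⟩, ⟨2, 8, ![-1, 0], ![-1, 1], true, true, 4, 3, 0, 0⟩],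
   [⟨3, 2, ![-2, 1], ![-1, 1], false, true, 0, 3, 0, 2⟩, ⟨3, 4, ![-2, 2], ![-1, 1], false, true, 0, 3, 0, 2⟩],
   [⟨4, 3, ![-2, 2], ![-1, 1], false, true, 0, 3, 0, 2⟩, ⟨4, 10, ![-1, 1], ![-1, 2], true, false, 3, 0, 1, 0⟩],
   [⟨5, 6, ![-1, -1], ![0, -1], false, true, 0, 5, 0, 3⟩, ⟨5, 12, ![0, -2], ![0, -1], false, true, 0, 5, 0, 4⟩],
   [⟨6, 0, ![-1, -1], ![-1, 0], false, true, 0, 4, 0, 3⟩, ⟨6, 5, ![-1, -1], ![0, -1], false, true, 0, 5, 0, 3⟩, ⟨6, 7, ![-1, 0], ![0, -1], true, true, 4, 5, 0, 0⟩],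
   [⟨7, 6, ![-1, 0], ![0, -1], true, true, 4, 5, 0, 0⟩, ⟨7, 8, ![-1, 0], ![0, 0], true, true, 4, 0, 0, 0⟩, ⟨7, 14, ![0, -1], ![0, 0], true, true, 5, 0, 0, 0⟩],
   [⟨8, 2, ![-1, 0], ![-1, 1], true, true, 4, 3, 0, 0⟩, ⟨8, 7, ![-1, 0], ![0, 0], true, true, 4, 0, 0, 0⟩, ⟨8, 9, ![-1, 1], ![0, 0], true, true, 3, 0, 0, 0⟩],
   [⟨9, 8, ![-1, 1], ![0, 0], true, true, 3, 0, 0, 0⟩, ⟨9, 10, ![-1, 1], ![0, 1], true, true, 3, 2, 0, 0⟩, ⟨9, 16, ![0, 0], ![0, 1], true, true, 0, 2, 0, 0⟩],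
   [⟨10, 4, ![-1, 1], ![-1, 2], true, false, 3, 0, 1, 0⟩, ⟨10, 9, ![-1, 1], ![0, 1], true, true, 3, 2, 0, 0⟩, ⟨10, 11, ![-1, 2], ![0, 1], false, true, 0, 2, 0, 1⟩],
   [⟨11, 10, ![-1, 2], ![0, 1], false, true, 0, 2, 0, 1⟩, ⟨11, 18, ![0, 1], ![0, 2], true, false, 2, 0, 1, 0⟩],
   [⟨12, 5, ![0, -2], ![0, -1], false, true, 0, 5, 0, 4⟩, ⟨12, 13, ![0, -1], ![1, -2], true, false, 5, 0, 4, 0⟩],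
   [⟨13, 12, ![0, -1], ![1, -2], true, false, 5, 0, 4, 0⟩, ⟨13, 14, ![0, -1], ![1, -1], true, true, 5, 6, 0, 0⟩, ⟨13, 19, ![1, -2], ![1, -1], false, true, 0, 6, 0, 4⟩],
   [⟨14, 7, ![0, -1], ![0, 0], true, true, 5, 0, 0, 0⟩, ⟨14, 13, ![0, -1], ![1, -1], true, true, 5, 6, 0, 0⟩, ⟨14, 15, ![0, 0], ![1, -1], true, true, 0, 6, 0, 0⟩],
   [⟨15, 14, ![0, 0], ![1, -1], true, true, 0, 6, 0, 0⟩, ⟨15, 16, ![0, 0], ![1, 0], true, true, 0, 1, 0, 0⟩, ⟨15, 21, ![1, -1], ![1, 0], true, true, 6, 1, 0, 0⟩],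
   [⟨16, 9, ![0, 0], ![0, 1], true, true, 0, 2, 0, 0⟩, ⟨16, 15, ![0, 0], ![1, 0], true, true, 0, 1, 0, 0⟩, ⟨16, 17, ![0, 1], ![1, 0], true, true, 2, 1, 0, 0⟩],
   [⟨17, 16, ![0, 1], ![1, 0], true, true, 2, 1, 0, 0⟩, ⟨17, 18, ![0, 1], ![1, 1], true, false, 2, 0, 0, 0⟩, ⟨17, 23, ![1, 0], ![1, 1], true, false, 1, 0, 0, 0⟩],
   [⟨18, 11, ![0, 1], ![0, 2], true, false, 2, 0, 1, 0⟩, ⟨18, 17, ![0, 1], ![1, 1], true, false, 2, 0, 0, 0⟩],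
   [⟨19, 13, ![1, -2], ![1, -1], false, true, 0, 6, 0, 4⟩, ⟨19, 20, ![1, -1], ![2, -2], true, false, 6, 0, 4, 0⟩],
   [⟨20, 19, ![1, -1], ![2, -2], true, false, 6, 0, 4, 0⟩, ⟨20, 21, ![1, -1], ![2, -1], true, false, 6, 0, 4, 0⟩],
   [⟨21, 15, ![1, -1], ![1, 0], true, true, 6, 1, 0, 0⟩, ⟨21, 20, ![1, -1], ![2, -1], true, false, 6, 0, 4, 0⟩, ⟨21, 22, ![1, 0], ![2, -1], true, false, 1, 0, 4, 0⟩],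
   [⟨22, 21, ![1, 0], ![2, -1], true, false, 1, 0, 4, 0⟩, ⟨22, 23, ![1, 0], ![2, 0], true, false, 1, 0, 0, 0⟩],
   [⟨23, 17, ![1, 0], ![1, 1], true, false, 1, 0, 0, 0⟩, ⟨23, 22, ![1, 0], ![2, 0], true, false, 1, 0, 0, 0⟩]]

/-- The 24 ordered pairs of `𝕋`-adjacent sites of `triBall 1` (bit positions). [cite: BollobasRiordan2006, Ch. 7 §7.2.2 pp. 168–171] -/
def siteAdj : List (ℕ × ℕ) :=
  [(0, 1), (0, 2), (0, 3), (0, 4), (0, 5), (0, 6), (1, 0), (1, 2), (1, 6), (2, 0), (2, 1), (2, 3), (3, 0), (3, 2), (3, 4), (4, 0), (4, 3), (4, 5), (5, 0), (5, 4), (5, 6), (6, 0), (6, 1), (6, 5)]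

/-- The arcs `A_i` of `hexBall1Five` as bit positions (`arc_eq`). [cite: BollobasRiordan2006, Ch. 7 §7.2.2 pp. 168–171] -/
def arcIdx : Fin 5 → List ℕ := ![[1, 2], [2, 3], [3, 4], [4, 5], [1, 5, 6]]


/-- Face at index `i` (junk: the corner face `y_0` beyond `23`, so that every value lies in `U1`). [cite: BollobasRiordan2006, Ch. 7 §7.2.2 pp. 168–171] -/
def faceAt (i : ℕ) : HexVertex := faceL.getD i (cornerT 0)

/-! ### R2. The checker -/

/-- All Boolean lists of length `n` (the `2ⁿ` configurations). [cite: BollobasRiordan2006, Ch. 7 §7.2.2 pp. 168–171] -/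
def allBits : ℕ → List (List Bool)
  | 0 => [[]]
  | n + 1 => (allBits n).flatMap fun l => [false :: l, true :: l]

/-- Bit `a` of a configuration (`false` beyond its length). [cite: BollobasRiordan2006, Ch. 7 §7.2.2 pp. 168–171] -/
def bit (cfg : List Bool) (a : ℕ) : Bool := cfg.getD a false

/-- `Bicol` on a tabulated face adjacency, read from the configuration bits. [cite: BollobasRiordan2006, Ch. 7 §7.2.2 pp. 168–171] -/
def bicolE (cfg : List Bool) (r : Fin 5) (c : Bool) (e : FEdge) : Bool :=
  (e.inU && e.inV && (bit cfg e.a != bit cfg e.b)) ||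
  (e.inU && !e.inV && (bit cfg e.a == (arcColour r c e.tuv == false))) ||
  (e.inV && !e.inU && (bit cfg e.b == (arcColour r c e.tvu == false)))

/-- Worklist breadth-first face closure: pop a face index `x`, push the targets of the bicoloured tabulated
adjacencies out of `x` not yet collected (fuelled; completeness is re-checked by `closedF`). [cite: BollobasRiordan2006, Ch. 7 §7.2.2 pp. 168–171] -/
def closGo (cfg : List Bool) (r : Fin 5) (c : Bool) : ℕ → List ℕ → List ℕ → List ℕ
  | 0, R, _ => R
  | _ + 1, R, [] => R
  | fuel + 1, R, x :: st =>
    let new := (adjL.getD x []).filterMap fun e =>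
      if bicolE cfg r c e && !R.elem e.j then some e.j else none
    closGo cfg r c fuel (R ++ new) (st ++ new)

/-- The face closure of `src`. [cite: BollobasRiordan2006, Ch. 7 §7.2.2 pp. 168–171] -/
def closF (cfg : List Bool) (r : Fin 5) (c : Bool) (src : ℕ) : List ℕ := closGo cfg r c 32 [src] [src]

/-- Closedness of a face set under the bicoloured tabulated adjacencies. [cite: BollobasRiordan2006, Ch. 7 §7.2.2 pp. 168–171] -/
def closedF (cfg : List Bool) (r : Fin 5) (c : Bool) (R : List ℕ) : Bool :=
  edgeTab.all fun e => !bicolE cfg r c e || !R.elem e.i || R.elem e.j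

/-- One round of the site closure inside the sites satisfying `A`. [cite: BollobasRiordan2006, Ch. 7 §7.2.2 pp. 168–171] -/
def expandS (A : ℕ → Bool) (R : List ℕ) : List ℕ :=
  R ++ siteAdj.filterMap fun p => if R.elem p.1 && A p.2 && !R.elem p.2 then some p.2 else none

/-- The site closure of `a` inside `A` (7 rounds; completeness re-checked by `closedS`). [cite: BollobasRiordan2006, Ch. 7 §7.2.2 pp. 168–171] -/
def closS (A : ℕ → Bool) (a : ℕ) : List ℕ := (expandS A)^[7] [a]

/-- Closedness of a site set under adjacency inside `A`. [cite: BollobasRiordan2006, Ch. 7 §7.2.2 pp. 168–171] -/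
def closedS (A : ℕ → Bool) (R : List ℕ) : Bool :=
  siteAdj.all fun p => !R.elem p.1 || !A p.2 || R.elem p.2

/-- A crossing from arc `i` to arc `j` inside `A`: some site of `A_i` satisfying `A` whose closure meets `A_j`. [cite: BollobasRiordan2006, Ch. 7 §7.2.2 pp. 168–171] -/
def crossE (A : ℕ → Bool) (i j : Fin 5) : Bool :=
  (arcIdx i).any fun a => A a && (arcIdx j).any fun b => (closS A a).elem b

/-- All site closures started on arc `i` inside `A` are closed. [cite: BollobasRiordan2006, Ch. 7 §7.2.2 pp. 168–171] -/
def crossOK (A : ℕ → Bool) (i : Fin 5) : Bool :=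
  (arcIdx i).all fun a => !A a || closedS A (closS A a)

/-- The check of one instance `(cfg, r)` of the rung (`c = false`). [cite: KhristoforovSmirnov2021, §1.2 Lemma 2] -/
def rungCase (cfg : List Bool) (r : Fin 5) : Bool :=
  let R := closF cfg r false (cornerIdx (r + 1))
  let opn : ℕ → Bool := bit cfg
  let cls : ℕ → Bool := fun a => !bit cfg a
  let mA := R.elem (cornerIdx (r + 2))
  let mB := R.elem (cornerIdx (r + 4))
  let oc := crossE opn (r + 1) (r + 3)
  let cc := crossE cls (r + 2) (r + 4) || crossE cls (r + 2) r
  closedF cfg r false R && crossOK opn (r + 1) && crossOK cls (r + 2) &&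
    (mA != mB) && (mB == oc) && (mA == cc)

/-- The rung checker at a fixed reference corner `r`: all `2⁷` configurations. [cite: KhristoforovSmirnov2021, §1.2 Lemma 2] -/
def rungCheckAt (r : Fin 5) : Bool := (allBits 7).all fun cfg => rungCase cfg r

/-- **The rung checker**: all `5 × 2⁷` instances. [cite: KhristoforovSmirnov2021, §1.2 Lemma 2] -/
def rungCheck : Bool := (List.finRange 5).all rungCheckAt


/-! ### R3. The tables are correct (finite checks against the definitions) -/

/-- `faceAt (cornerIdx j)` is the corner face `y_j`. [cite: BollobasRiordan2006, Ch. 7 §7.2.2 pp. 168–171] -/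
theorem faceAt_cornerIdx (j : Fin 5) : faceAt (cornerIdx j) = cornerT j := by
  fin_cases j <;> rfl

/-- Corner indices are in range. [cite: BollobasRiordan2006, Ch. 7 §7.2.2 pp. 168–171] -/
theorem cornerIdx_lt (j : Fin 5) : cornerIdx j < 24 := by
  fin_cases j <;> decide

/-- Every tabulated face lies in the face universe `U1` of the ball (and so does the junk value). [cite: BollobasRiordan2006, Ch. 7 §7.2.2 pp. 168–171] -/
theorem faceAt_mem_U1 (i : ℕ) : faceAt i ∈ U1 := by
  by_cases hi : i < 24
  · have key : ∀ k < 24, faceAt k ∈ U1 := by decide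
    exact key i hi
  · have : faceAt i = cornerT 0 := by
      unfold faceAt
      rw [List.getD_eq_getElem?_getD, List.getElem?_eq_none_iff.2 (by simp [faceL]; omega)]
      rfl
    rw [this]
    decide

/-- `faceAt` is injective on `[0, 24)`. [cite: BollobasRiordan2006, Ch. 7 §7.2.2 pp. 168–171] -/
theorem faceAt_inj : ∀ i < 24, ∀ j < 24, faceAt i = faceAt j → i = j := by
  decide

/-- Table indices are in range. [cite: BollobasRiordan2006, Ch. 7 §7.2.2 pp. 168–171] -/
theorem edgeTab_lt : ∀ e ∈ edgeTab, e.i < 24 ∧ e.j < 24 := by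
  decide

/-- The grouped table consists of entries of `edgeTab` with the right source. [cite: BollobasRiordan2006, Ch. 7 §7.2.2 pp. 168–171] -/
theorem adjL_ok : ∀ x < 24, ∀ e ∈ adjL.getD x [], e ∈ edgeTab ∧ e.i = x := by
  decide

/-- Beyond the table the groups are empty. [cite: BollobasRiordan2006, Ch. 7 §7.2.2 pp. 168–171] -/
theorem adjL_getD_of_le {x : ℕ} (hx : 24 ≤ x) : adjL.getD x [] = [] := by
  rw [List.getD_eq_getElem?_getD, List.getElem?_eq_none (by simp [adjL]; omega)]
  rfl

/-- Membership in a group: an entry of `edgeTab` out of `x`. [cite: BollobasRiordan2006, Ch. 7 §7.2.2 pp. 168–171] -/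
theorem mem_adjL {x : ℕ} {e : FEdge} (h : e ∈ adjL.getD x []) : e ∈ edgeTab ∧ e.i = x := by
  by_cases hx : x < 24
  · exact adjL_ok x hx e h
  · rw [adjL_getD_of_le (by omega)] at h; simp at h

/-- **The face-adjacency table is correct**: adjacency, the common edge, ball membership and bit positions of its
endpoints, and the stretch indices of the two darts. [cite: BollobasRiordan2006, Ch. 7 §7.2.2 pp. 168–171] -/
theorem edgeTab_ok : ∀ e ∈ edgeTab,
    hexGraph.Adj (faceAt e.i) (faceAt e.j) ∧ faceEdge (faceAt e.i) (faceAt e.j) = {e.u, e.v} ∧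
    (e.inU = true ↔ e.u ∈ triBall 1) ∧ (e.inV = true ↔ e.v ∈ triBall 1) ∧
    (e.inU = true → e.a < 7 ∧ ballAt e.a = e.u) ∧ (e.inV = true → e.b < 7 ∧ ballAt e.b = e.v) ∧
    stretchT (e.u, e.v) = e.tuv ∧ stretchT (e.v, e.u) = e.tvu := by
  decide

/-- **The face-adjacency table is complete**: every `H`-adjacency out of a tabulated face into `U1` across an edge
with an endpoint in the ball is tabulated. [cite: BollobasRiordan2006, Ch. 7 §7.2.2 pp. 168–171] -/
theorem edgeTab_complete : ∀ i < 24, ∀ F' ∈ U1, hexGraph.Adj (faceAt i) F' →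
    (∃ s ∈ faceEdge (faceAt i) F', s ∈ triBall 1) →
      (edgeTab.any fun e => e.i == i && decide (faceAt e.j = F')) = true := by
  decide

/-- The site table: indices in range and adjacent. [cite: BollobasRiordan2006, Ch. 7 §7.2.2 pp. 168–171] -/
theorem siteAdj_ok : ∀ p ∈ siteAdj, p.1 < 7 ∧ p.2 < 7 ∧ triGraph.Adj (ballAt p.1) (ballAt p.2) := by
  decide

/-- The site table is complete. [cite: BollobasRiordan2006, Ch. 7 §7.2.2 pp. 168–171] -/
theorem siteAdj_complete : ∀ a < 7, ∀ b < 7, triGraph.Adj (ballAt a) (ballAt b) →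
    siteAdj.elem (a, b) = true := by
  decide

/-- `ballAt` enumerates `triBall 1`. [cite: BollobasRiordan2006, Ch. 7 §7.2.2 pp. 168–171] -/
theorem ballAt_mem : ∀ a < 7, ballAt a ∈ triBall 1 := by
  decide

/-- Every site of the ball has a bit position. [cite: BollobasRiordan2006, Ch. 7 §7.2.2 pp. 168–171] -/
theorem exists_ballAt : ∀ s ∈ triBall 1, ∃ a < 7, ballAt a = s := by
  decide

/-- `ballAt` is injective on `[0, 7)`. [cite: BollobasRiordan2006, Ch. 7 §7.2.2 pp. 168–171] -/
theorem ballAt_inj : ∀ a < 7, ∀ b < 7, ballAt a = ballAt b → a = b := by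
  decide

/-- Arc indices are in range. [cite: BollobasRiordan2006, Ch. 7 §7.2.2 pp. 168–171] -/
theorem arcIdx_lt : ∀ i : Fin 5, ∀ a ∈ arcIdx i, a < 7 := by
  decide

/-- **The arcs of `hexBall1Five` are the tabulated ones.** [cite: BollobasRiordan2006, Ch. 7 §7.2.2 pp. 168–171] -/
theorem arc_eq (i : Fin 5) : hexBall1Five.arc i = ((arcIdx i).map ballAt).toFinset := by
  fin_cases i <;> (simp only [TriMarkedDomain.arc, stretch_eq_stretchS]; decide)


/-! ### R4. Configurations as bit lists -/

/-- The bit list of a finite site set: bit `a` records `ballAt a ∈ S`. [cite: BollobasRiordan2006, Ch. 7 §7.2.2 pp. 168–171] -/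
def encode (S : Finset (Site 2)) : List Bool := (List.range 7).map fun a => decide (ballAt a ∈ S)

/-- Every Boolean list of length `n` is enumerated by `allBits n`. [cite: BollobasRiordan2006, Ch. 7 §7.2.2 pp. 168–171] -/
theorem mem_allBits : ∀ l : List Bool, l ∈ allBits l.length := by
  intro l
  induction l with
  | nil => simp [allBits]
  | cons b l ih =>
    simp only [List.length_cons, allBits, List.mem_flatMap, List.mem_cons, List.not_mem_nil, or_false]
    refine ⟨l, ih, ?_⟩
    cases b
    · exact Or.inl rfl
    · exact Or.inr rfl

/-- The encoding of a site set is one of the `2⁷` configurations. [cite: BollobasRiordan2006, Ch. 7 §7.2.2 pp. 168–171] -/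
theorem encode_mem (S : Finset (Site 2)) : encode S ∈ allBits 7 := by
  have h := mem_allBits (encode S)
  have hl : (encode S).length = 7 := by simp [encode]
  rwa [hl] at h

/-- The bits of the encoding. [cite: BollobasRiordan2006, Ch. 7 §7.2.2 pp. 168–171] -/
theorem bit_encode (S : Finset (Site 2)) {a : ℕ} (ha : a < 7) : bit (encode S) a = decide (ballAt a ∈ S) := by
  unfold bit encode
  rw [List.getD_eq_getElem?_getD, List.getElem?_map, List.getElem?_range ha]
  rfl

/-! ### R5. `Bicol` on a tabulated adjacency -/

/-- `BicolS` is symmetric in the two endpoints. [cite: BollobasRiordan2006, Ch. 7 §7.2.2 pp. 168–171] -/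
theorem bicolS_symm (S : Finset (Site 2)) (r : Fin 5) (c : Bool) (u v : Site 2) :
    BicolS S r c v u ↔ BicolS S r c u v := by
  unfold BicolS
  constructor
  · rintro (⟨h1, h2, h3⟩ | ⟨h1, h2, h3⟩ | ⟨h1, h2, h3⟩)
    · exact Or.inl ⟨h2, h1, by tauto⟩
    · exact Or.inr (Or.inr ⟨h1, h2, h3⟩)
    · exact Or.inr (Or.inl ⟨h1, h2, h3⟩)
  · rintro (⟨h1, h2, h3⟩ | ⟨h1, h2, h3⟩ | ⟨h1, h2, h3⟩)
    · exact Or.inl ⟨h2, h1, by tauto⟩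
    · exact Or.inr (Or.inr ⟨h1, h2, h3⟩)
    · exact Or.inr (Or.inl ⟨h1, h2, h3⟩)

/-- **The tabulated `Bicol` is `BicolS`** on the encoded configuration. [cite: BollobasRiordan2006, Ch. 7 §7.2.2 pp. 168–171] -/
theorem bicolE_iff (S : Finset (Site 2)) (r : Fin 5) (c : Bool) {e : FEdge} (he : e ∈ edgeTab) :
    bicolE (encode S) r c e = true ↔ BicolS S r c e.u e.v := by
  obtain ⟨-, -, hU, hV, ha, hb, ht1, ht2⟩ := edgeTab_ok e he
  unfold bicolE BicolS
  rw [ht1, ht2]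
  cases hiu : e.inU <;> cases hiv : e.inV
  · -- neither endpoint in the ball: both sides false
    have hu : e.u ∉ triBall 1 := fun h => by simpa [hiu] using hU.2 h
    have hv : e.v ∉ triBall 1 := fun h => by simpa [hiv] using hV.2 h
    simp [hu, hv]
  · -- only `v` in the ball
    have hu : e.u ∉ triBall 1 := fun h => by simpa [hiu] using hU.2 h
    have hv : e.v ∈ triBall 1 := hV.1 hiv
    obtain ⟨hb7, hbv⟩ := hb hiv
    rw [bit_encode S hb7, hbv]
    cases hcol : arcColour r c e.tvu <;> by_cases hvS : e.v ∈ S <;> simp [hu, hv, hvS]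
  · -- only `u` in the ball
    have hu : e.u ∈ triBall 1 := hU.1 hiu
    have hv : e.v ∉ triBall 1 := fun h => by simpa [hiv] using hV.2 h
    obtain ⟨ha7, hau⟩ := ha hiu
    rw [bit_encode S ha7, hau]
    cases hcol : arcColour r c e.tuv <;> by_cases huS : e.u ∈ S <;> simp [hu, hv, huS]
  · -- both in the ball
    have hu : e.u ∈ triBall 1 := hU.1 hiu
    have hv : e.v ∈ triBall 1 := hV.1 hiv
    obtain ⟨ha7, hau⟩ := ha hiu
    obtain ⟨hb7, hbv⟩ := hb hiv
    rw [bit_encode S ha7, hau, bit_encode S hb7, hbv]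
    by_cases huS : e.u ∈ S <;> by_cases hvS : e.v ∈ S <;> simp [hu, hv, huS, hvS]

/-- A tabulated adjacency whose `Bicol` bit is set is an `IStepS` step. [cite: BollobasRiordan2006, Ch. 7 §7.2.2 pp. 168–171] -/
theorem iStepS_of_bicolE (S : Finset (Site 2)) (r : Fin 5) (c : Bool) {e : FEdge} (he : e ∈ edgeTab)
    (hb : bicolE (encode S) r c e = true) : IStepS S r c (faceAt e.i) (faceAt e.j) := by
  obtain ⟨hadj, hfe, -⟩ := edgeTab_ok e he
  refine ⟨hadj, e.u, ?_, e.v, ?_, hfe, (bicolE_iff S r c he).1 hb⟩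
  · rw [hfe]; exact Finset.mem_insert_self _ _
  · rw [hfe]; exact Finset.mem_insert_of_mem (Finset.mem_singleton_self _)

/-! ### R6. The face closure: soundness (everything collected is reachable) -/

/-- Invariants of the worklist closure: a property of indices preserved along bicoloured tabulated adjacencies
and holding on the initial set and stack holds on the result. [cite: BollobasRiordan2006, Ch. 7 §7.2.2 pp. 168–171] -/
theorem closGo_inv (cfg : List Bool) (r : Fin 5) (c : Bool) (P : ℕ → Prop)
    (hP : ∀ e ∈ edgeTab, bicolE cfg r c e = true → P e.i → P e.j) :
    ∀ (fuel : ℕ) (R st : List ℕ), (∀ x ∈ R, P x) → (∀ x ∈ st, P x) → ∀ x ∈ closGo cfg r c fuel R st, P x := by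
  intro fuel
  induction fuel with
  | zero => intro R st hR _ x hx; exact hR x hx
  | succ fuel ih =>
    intro R st hR hst
    cases st with
    | nil => intro x hx; exact hR x hx
    | cons y st =>
      simp only [closGo]
      have hy : P y := hst y List.mem_cons_self
      have hnew : ∀ x ∈ (adjL.getD y []).filterMap (fun e =>
          if bicolE cfg r c e && !R.elem e.j then some e.j else none), P x := by
        intro x hx
        obtain ⟨e, he, hex⟩ := List.mem_filterMap.1 hx
        split_ifs at hex with hcond
        obtain ⟨h2, -⟩ : bicolE cfg r c e = true ∧ (!R.elem e.j) = true := by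
          simpa [Bool.and_eq_true] using hcond
        rw [Option.some.injEq] at hex
        subst hex
        obtain ⟨he', hiy⟩ := mem_adjL he
        exact hP e he' h2 (hiy ▸ hy)
      refine ih _ _ ?_ ?_
      · intro x hx
        rcases List.mem_append.1 hx with h | h
        · exact hR x h
        · exact hnew x h
      · intro x hx
        rcases List.mem_append.1 hx with h | h
        · exact hst x (List.mem_cons_of_mem _ h)
        · exact hnew x h

/-- The source index belongs to its closure. [cite: BollobasRiordan2006, Ch. 7 §7.2.2 pp. 168–171] -/
theorem src_mem_closGo (cfg : List Bool) (r : Fin 5) (c : Bool) :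
    ∀ (fuel : ℕ) (R st : List ℕ) (x : ℕ), x ∈ R → x ∈ closGo cfg r c fuel R st := by
  intro fuel
  induction fuel with
  | zero => intro R st x hx; exact hx
  | succ fuel ih =>
    intro R st x hx
    cases st with
    | nil => exact hx
    | cons y st => simp only [closGo]; exact ih _ _ x (List.mem_append_left _ hx)

/-- Indices in a face closure are in range. [cite: BollobasRiordan2006, Ch. 7 §7.2.2 pp. 168–171] -/
theorem closF_lt (cfg : List Bool) (r : Fin 5) (c : Bool) {src : ℕ} (hsrc : src < 24) :
    ∀ x ∈ closF cfg r c src, x < 24 :=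
  closGo_inv cfg r c (· < 24) (fun e he _ _ => (edgeTab_lt e he).2) 32 [src] [src]
    (by simpa using hsrc) (by simpa using hsrc)

/-- **Soundness of the face closure**: every collected face is linked to the source face through bicoloured
edges. [cite: BollobasRiordan2006, Ch. 7 §7.2.2 pp. 168–171] -/
theorem closF_reach (S : Finset (Site 2)) (r : Fin 5) (c : Bool) (src : ℕ) :
    ∀ x ∈ closF (encode S) r c src,
      Relation.ReflTransGen (IStepS S r c) (faceAt src) (faceAt x) :=
  closGo_inv (encode S) r c (fun x => Relation.ReflTransGen (IStepS S r c) (faceAt src) (faceAt x))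
    (fun e he hb hi => hi.tail (iStepS_of_bicolE S r c he hb)) 32 [src] [src]
    (fun x hx => by rw [List.mem_singleton] at hx; subst hx; exact Relation.ReflTransGen.refl)
    (fun x hx => by rw [List.mem_singleton] at hx; subst hx; exact Relation.ReflTransGen.refl)

/-! ### R7. The face closure: completeness from the closedness flag -/

/-- An `IStepS` step out of a tabulated face is a tabulated adjacency with its `Bicol` bit set. [cite: BollobasRiordan2006, Ch. 7 §7.2.2 pp. 168–171] -/
theorem exists_edge_of_iStepS (S : Finset (Site 2)) (r : Fin 5) (c : Bool) {x : ℕ} (hx : x < 24)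
    {F' : HexVertex} (h : IStepS S r c (faceAt x) F') :
    ∃ e ∈ edgeTab, e.i = x ∧ faceAt e.j = F' ∧ bicolE (encode S) r c e = true := by
  obtain ⟨hadj, u', hu', v', hv', hfe, hbic⟩ := h
  have hF' : F' ∈ U1 := by
    have := (IStep.mem_facesOf hexBall1Five ((iStep_iff_S S r c (faceAt x) F').2
      ⟨hadj, u', hu', v', hv', hfe, hbic⟩)).2
    simpa [U1] using this
  have hball : ∃ s ∈ faceEdge (faceAt x) F', s ∈ triBall 1 := by
    rcases hbic with ⟨h1, -, -⟩ | ⟨h1, -, -⟩ | ⟨h1, -, -⟩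
    · exact ⟨u', hu', h1⟩
    · exact ⟨u', hu', h1⟩
    · exact ⟨v', hv', h1⟩
  obtain ⟨e, he, hcond⟩ := List.any_eq_true.1 (edgeTab_complete x hx F' hF' hadj hball)
  obtain ⟨hi, hj⟩ : (e.i == x) = true ∧ decide (faceAt e.j = F') = true := by
    simpa [Bool.and_eq_true] using hcond
  have hi' : e.i = x := by simpa using hi
  have hj' : faceAt e.j = F' := by simpa using hj
  refine ⟨e, he, hi', hj', (bicolE_iff S r c he).2 ?_⟩
  -- the common edge of the table entry is `{u', v'}`
  obtain ⟨-, hfe', -⟩ := edgeTab_ok e he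
  rw [hi', hj', hfe] at hfe'
  have hpair : (u' = e.u ∧ v' = e.v) ∨ (u' = e.v ∧ v' = e.u) := by
    have := congrArg (fun s : Finset (Site 2) => (s : Set (Site 2))) hfe'
    simp only [Finset.coe_insert, Finset.coe_singleton] at this
    exact Set.pair_eq_pair_iff.1 this
  rcases hpair with ⟨rfl, rfl⟩ | ⟨rfl, rfl⟩
  · exact hbic
  · exact (bicolS_symm S r c _ _).1 hbic

/-- **Completeness of the face closure**: if the closedness flag holds, the faces of the closure form a set closed
under `IStepS`. [cite: BollobasRiordan2006, Ch. 7 §7.2.2 pp. 168–171] -/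
theorem closF_closed (S : Finset (Site 2)) (r : Fin 5) (c : Bool) {src : ℕ} (hsrc : src < 24)
    (hcl : closedF (encode S) r c (closF (encode S) r c src) = true) :
    ∀ F ∈ ((closF (encode S) r c src).map faceAt).toFinset, ∀ F', IStepS S r c F F' →
      F' ∈ ((closF (encode S) r c src).map faceAt).toFinset := by
  intro F hF F' hst
  rw [List.mem_toFinset, List.mem_map] at hF ⊢
  obtain ⟨x, hx, rfl⟩ := hF
  have hx24 := closF_lt (encode S) r c hsrc x hx
  obtain ⟨e, he, hei, hej, hb⟩ := exists_edge_of_iStepS S r c hx24 hst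
  refine ⟨e.j, ?_, hej⟩
  have := (List.all_eq_true.1 hcl) e he
  simp [hb] at this
  exact this.resolve_left (fun h => h (hei ▸ hx))

/-! ### R8. The link patterns, rendered -/

/-- Linking of the corner faces `y_j`, `y_{j'}` through bicoloured edges, rendered by the face closure. [cite: BollobasRiordan2006, Ch. 7 §7.2.2 pp. 168–171] -/
theorem linked_iff_closF (S : Finset (Site 2)) (r : Fin 5) (c : Bool) (j j' : Fin 5)
    (hcl : closedF (encode S) r c (closF (encode S) r c (cornerIdx j)) = true) :
    (∃ Y₁ Y₂ : HexVertex, IsCornerFace hexBall1Five j Y₁ ∧ IsCornerFace hexBall1Five j' Y₂ ∧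
      Relation.ReflTransGen (IStep hexBall1Five (↑S) r c) Y₁ Y₂) ↔
      cornerIdx j' ∈ closF (encode S) r c (cornerIdx j) := by
  constructor
  · rintro ⟨Y₁, Y₂, h₁, h₂, hreach⟩
    rw [isCornerFace_iff] at h₁ h₂
    subst h₁; subst h₂
    rw [iStep_eq_S] at hreach
    have hmem : cornerT j' ∈ ((closF (encode S) r c (cornerIdx j)).map faceAt).toFinset := by
      refine reach_mem_of_closed (src := {cornerT j}) ?_ (closF_closed S r c (cornerIdx_lt j) hcl)
        (Finset.mem_singleton_self _) hreach
      intro F hF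
      rw [Finset.mem_singleton] at hF
      subst hF
      rw [List.mem_toFinset, List.mem_map]
      exact ⟨cornerIdx j, src_mem_closGo _ _ _ _ _ _ _ (by simp), faceAt_cornerIdx j⟩
    rw [List.mem_toFinset, List.mem_map] at hmem
    obtain ⟨x, hx, hxe⟩ := hmem
    have hx24 := closF_lt (encode S) r c (cornerIdx_lt j) x hx
    rw [← faceAt_cornerIdx] at hxe
    rwa [faceAt_inj x hx24 (cornerIdx j') (cornerIdx_lt j') hxe] at hx
  · intro h
    refine ⟨cornerT j, cornerT j', (isCornerFace_iff j _).2 rfl, (isCornerFace_iff j' _).2 rfl, ?_⟩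
    rw [iStep_eq_S, ← faceAt_cornerIdx, ← faceAt_cornerIdx]
    exact closF_reach S r c (cornerIdx j) _ h

/-! ### R9. Crossings, rendered -/

/-- The site expansion only adds sites. [cite: BollobasRiordan2006, Ch. 7 §7.2.2 pp. 168–171] -/
theorem mem_iterate_expandS (Ab : ℕ → Bool) (a : ℕ) : ∀ (n : ℕ) (R : List ℕ), a ∈ R → a ∈ (expandS Ab)^[n] R := by
  intro n
  induction n with
  | zero => intro R h; exact h
  | succ n ih => intro R h; rw [Function.iterate_succ_apply']; exact List.mem_append_left _ (ih R h)

/-- Membership in an iterate of the site expansion: in range, and reachable inside `A` from the start. [cite: BollobasRiordan2006, Ch. 7 §7.2.2 pp. 168–171] -/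
theorem expandS_inv (Ab : ℕ → Bool) (A : Set (Site 2)) (hA : ∀ a < 7, Ab a = true → ballAt a ∈ A)
    {a₀ : ℕ} (ha₀ : a₀ < 7) : ∀ (n : ℕ), ∀ b ∈ (expandS Ab)^[n] [a₀], b < 7 ∧
      Relation.ReflTransGen (fun x y => triGraph.Adj x y ∧ y ∈ A) (ballAt a₀) (ballAt b) := by
  intro n
  induction n with
  | zero => intro b hb; simp at hb; subst hb; exact ⟨ha₀, Relation.ReflTransGen.refl⟩
  | succ n ih =>
    intro b hb
    rw [Function.iterate_succ_apply'] at hb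
    set R := (expandS Ab)^[n] [a₀] with hR
    unfold expandS at hb
    rcases List.mem_append.1 hb with h | h
    · exact ih b h
    · obtain ⟨p, hp, hpb⟩ := List.mem_filterMap.1 h
      split_ifs at hpb with hcond
      rw [Option.some.injEq] at hpb
      subst hpb
      obtain ⟨⟨h1, h2⟩, -⟩ : (p.1 ∈ R ∧ Ab p.2 = true) ∧ p.2 ∉ R := by
        simpa using hcond
      obtain ⟨-, hp2, hadj⟩ := siteAdj_ok p hp
      obtain ⟨-, hreach⟩ := ih p.1 h1
      exact ⟨hp2, hreach.tail ⟨hadj, hA p.2 hp2 h2⟩⟩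

/-- **Crossings rendered**: for a site set `A ⊆ triBall 1` read through the bits `Ab`, and a closed site closure,
a `PathIn` crossing from arc `i` to arc `j` inside `A` exists iff the checker finds one. [cite: BollobasRiordan2006, Ch. 7 §7.2.2 pp. 168–171] -/
theorem cross_iff (Ab : ℕ → Bool) (A : Set (Site 2)) (hAball : A ⊆ ↑(triBall 1))
    (hA : ∀ a < 7, (ballAt a ∈ A ↔ Ab a = true)) (i j : Fin 5) (hok : crossOK Ab i = true) :
    (∃ u ∈ hexBall1Five.arc i, ∃ v ∈ hexBall1Five.arc j, PathIn triGraph A u v) ↔ crossE Ab i j = true := by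
  rw [arc_eq, arc_eq]
  constructor
  · rintro ⟨u, hu, v, hv, huA, hpath⟩
    rw [List.mem_toFinset, List.mem_map] at hu hv
    obtain ⟨a, ha, rfl⟩ := hu
    obtain ⟨b, hb, rfl⟩ := hv
    have ha7 := arcIdx_lt i a ha
    have hb7 := arcIdx_lt j b hb
    have hAa : Ab a = true := (hA a ha7).1 huA
    -- the closure from `a` is closed, hence contains every site reachable inside `A`
    have hcl : closedS Ab (closS Ab a) = true := by
      have := (List.all_eq_true.1 hok) a ha
      simpa [hAa] using this
    have key : ∀ y, Relation.ReflTransGen (fun x y => triGraph.Adj x y ∧ y ∈ A) (ballAt a) y →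
        ∃ b' ∈ closS Ab a, b' < 7 ∧ ballAt b' = y := by
      intro y hy
      induction hy with
      | refl => exact ⟨a, mem_iterate_expandS Ab a 7 [a] (List.mem_singleton_self a), ha7, rfl⟩
      | tail _ hst ih =>
        obtain ⟨b', hb', hb'7, rfl⟩ := ih
        obtain ⟨hadj, hyA⟩ := hst
        obtain ⟨b'', hb''7, rfl⟩ := exists_ballAt _ (hAball hyA)
        have hel := siteAdj_complete b' hb'7 b'' hb''7 hadj
        have hmem : (b', b'') ∈ siteAdj := List.mem_of_elem_eq_true hel
        have := (List.all_eq_true.1 hcl) (b', b'') hmem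
        have h2 : Ab b'' = true := (hA b'' hb''7).1 hyA
        simp [h2] at this
        exact ⟨b'', this.resolve_left (fun h => h hb'), hb''7, rfl⟩
    obtain ⟨b', hb'mem, hb'7, hb'eq⟩ := key _ hpath
    have hbb : b' = b := ballAt_inj b' hb'7 b hb7 hb'eq
    have hbmem : b ∈ closS Ab a := hbb ▸ hb'mem
    unfold crossE
    rw [List.any_eq_true]
    refine ⟨a, ha, ?_⟩
    rw [Bool.and_eq_true]
    exact ⟨hAa, List.any_eq_true.2 ⟨b, hb, List.elem_eq_true_of_mem hbmem⟩⟩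
  · intro h
    unfold crossE at h
    obtain ⟨a, ha, hcond⟩ := List.any_eq_true.1 h
    obtain ⟨hAa, hex⟩ : Ab a = true ∧ ((arcIdx j).any fun b => (closS Ab a).elem b) = true := by
      simpa [Bool.and_eq_true] using hcond
    obtain ⟨b, hb, hbel⟩ := List.any_eq_true.1 hex
    have ha7 := arcIdx_lt i a ha
    have hA' : ∀ a < 7, Ab a = true → ballAt a ∈ A := fun a ha h => (hA a ha).2 h
    obtain ⟨-, hreach⟩ := expandS_inv Ab A hA' ha7 7 b (List.mem_of_elem_eq_true hbel)
    refine ⟨ballAt a, ?_, ballAt b, ?_, (hA a ha7).2 hAa, hreach⟩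
    · rw [List.mem_toFinset, List.mem_map]; exact ⟨a, ha, rfl⟩
    · rw [List.mem_toFinset, List.mem_map]; exact ⟨b, hb, rfl⟩


/-! ### R10. Assembly: the rung -/

/-- Open crossings of `hexBall1Five` rendered by the checker. [cite: BollobasRiordan2006, Ch. 7 §7.2.2 pp. 168–171] -/
theorem open_iff (S : Finset (Site 2)) (i j : Fin 5) (hok : crossOK (bit (encode S)) i = true) :
    hexBall1Five.IsOpenCrossing (↑S) i j ↔ crossE (bit (encode S)) i j = true := by
  unfold TriMarkedDomain.IsOpenCrossing
  rw [hexBall1Five_verts]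
  refine cross_iff (bit (encode S)) (↑(triBall 1) ∩ ↑S) Set.inter_subset_left (fun a ha => ?_) i j hok
  rw [bit_encode S ha]
  simp [ballAt_mem a ha]

/-- Closed crossings of `hexBall1Five` rendered by the checker. [cite: BollobasRiordan2006, Ch. 7 §7.2.2 pp. 168–171] -/
theorem closed_iff (S : Finset (Site 2)) (i j : Fin 5) (hok : crossOK (fun a => !bit (encode S) a) i = true) :
    hexBall1Five.IsClosedCrossing (↑S) i j ↔ crossE (fun a => !bit (encode S) a) i j = true := by
  unfold TriMarkedDomain.IsClosedCrossing
  rw [hexBall1Five_verts]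
  refine cross_iff (fun a => !bit (encode S) a) (↑(triBall 1) ∩ (↑S)ᶜ) Set.inter_subset_left
    (fun a ha => ?_) i j hok
  rw [bit_encode S ha]
  simp [ballAt_mem a ha]

/-- Boolean bookkeeping for one instance. [cite: BollobasRiordan2006, Ch. 7 §7.2.2 pp. 168–171] -/
private theorem xor_of_bools {P Q O C : Prop} {p q o c₁ c₂ : Bool} (hP : P ↔ p = true) (hQ : Q ↔ q = true)
    (hO : O ↔ o = true) (hC : C ↔ (c₁ = true ∨ c₂ = true)) (hx : (p != q) = true) (hqo : (q == o) = true)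
    (hpc : (p == (c₁ || c₂)) = true) : Xor P Q ∧ (Q ↔ O) ∧ (P ↔ C) := by
  rw [hP, hQ, hO, hC]
  revert hx hqo hpc
  cases p <;> cases q <;> cases o <;> cases c₁ <;> cases c₂ <;> simp [Xor]

/-- **Soundness of one instance of the checker.** [cite: BollobasRiordan2006, Ch. 7 §7.2.2 pp. 168–171] -/
theorem rungCase_sound (S : Finset (Site 2)) (r : Fin 5) (h : rungCase (encode S) r = true) :
    Xor (MatchA hexBall1Five (↑S) r false) (MatchB hexBall1Five (↑S) r false) ∧
    (MatchB hexBall1Five (↑S) r false ↔ hexBall1Five.IsOpenCrossing (↑S) (r + 1) (r + 3)) ∧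
    (MatchA hexBall1Five (↑S) r false ↔
      (hexBall1Five.IsClosedCrossing (↑S) (r + 2) (r + 4) ∨ hexBall1Five.IsClosedCrossing (↑S) (r + 2) r)) := by
  unfold rungCase at h
  simp only [Bool.and_eq_true] at h
  obtain ⟨⟨⟨⟨⟨hclF, hokO⟩, hokC⟩, hx⟩, hBo⟩, hAc⟩ := h
  have hA : MatchA hexBall1Five (↑S) r false ↔
      cornerIdx (r + 2) ∈ closF (encode S) r false (cornerIdx (r + 1)) :=
    linked_iff_closF S r false (r + 1) (r + 2) hclF
  have hB : MatchB hexBall1Five (↑S) r false ↔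
      cornerIdx (r + 4) ∈ closF (encode S) r false (cornerIdx (r + 1)) :=
    linked_iff_closF S r false (r + 1) (r + 4) hclF
  refine xor_of_bools (hA.trans List.elem_iff.symm) (hB.trans List.elem_iff.symm) (open_iff S _ _ hokO)
    ((closed_iff S _ _ hokC).or (closed_iff S _ _ hokC)) hx hBo hAc

/-- **Soundness of the rung checker.** [cite: KhristoforovSmirnov2021, §1.2 Lemma 2] -/
theorem fiveMarkedLoopLemmaFin_of_rungCheck (h : rungCheck = true) : FiveMarkedLoopLemmaFin hexBall1Five := by
  intro S _ r
  have h1 := (List.all_eq_true.1 h) r (List.mem_finRange r)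
  exact rungCase_sound S r ((List.all_eq_true.1 h1) (encode S) (encode_mem S))

/-! ### R11. Kernel evaluation (standard axioms: `decide +kernel`, no `native_decide`) -/

/-- The `2⁷` instances at `r = 0`. [cite: BollobasRiordan2006, Ch. 7 §7.2.2 pp. 168–171] -/
theorem rungCheckAt_0 : rungCheckAt 0 = true := by decide +kernel
/-- The `2⁷` instances at `r = 1`. [cite: BollobasRiordan2006, Ch. 7 §7.2.2 pp. 168–171] -/
theorem rungCheckAt_1 : rungCheckAt 1 = true := by decide +kernel
/-- The `2⁷` instances at `r = 2`. [cite: BollobasRiordan2006, Ch. 7 §7.2.2 pp. 168–171] -/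
theorem rungCheckAt_2 : rungCheckAt 2 = true := by decide +kernel
/-- The `2⁷` instances at `r = 3`. [cite: BollobasRiordan2006, Ch. 7 §7.2.2 pp. 168–171] -/
theorem rungCheckAt_3 : rungCheckAt 3 = true := by decide +kernel
/-- The `2⁷` instances at `r = 4`. [cite: BollobasRiordan2006, Ch. 7 §7.2.2 pp. 168–171] -/
theorem rungCheckAt_4 : rungCheckAt 4 = true := by decide +kernel

/-- All `640` instances. [cite: BollobasRiordan2006, Ch. 7 §7.2.2 pp. 168–171] -/
theorem rungCheck_true : rungCheck = true := by
  unfold rungCheck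
  rw [List.all_eq_true]
  intro r _
  fin_cases r
  · exact rungCheckAt_0
  · exact rungCheckAt_1
  · exact rungCheckAt_2
  · exact rungCheckAt_3
  · exact rungCheckAt_4

/-- ★ **THE RUNG: the finite five-marked loop lemma holds on the smallest five-marked domain `hexBall1Five`**
(7 sites, `2⁷` colourings, five reference corners): for every colouring `S ⊆ triBall 1` and every `r`, exactly one of
the link patterns `A = [y_{r+1} ↔ y_{r+2}]`, `B = [y_{r+1} ↔ y_{r+4}]` occurs, `B` iff there is an open crossing
`A_{r+1} ↔ A_{r+3}`, `A` iff there is a closed crossing `A_{r+2} → A_{r+4}` or `A_{r+2} → A_r`. Kernel fact on standard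
axioms. [cite: KhristoforovSmirnov2021, §1.2 Lemma 2] -/
theorem fiveMarkedLoopLemmaFin_hexBall1Five : FiveMarkedLoopLemmaFin hexBall1Five :=
  fiveMarkedLoopLemmaFin_of_rungCheck rungCheck_true

/-- Hence the (v-c) five-marked loop lemma on `hexBall1Five` for ALL configurations `σ : Set (Site 2)`, modulo the
locality face (L1) `LoopLocal hexBall1Five` (the crossing locality (L2) holds for every domain, `crossLocal_holds`). [cite: KhristoforovSmirnov2021, §1.2 Lemma 2] -/
theorem fiveMarkedLoopLemma_hexBall1Five_of_loopLocal (hL : LoopLocal hexBall1Five) :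
    FiveMarkedLoopLemma hexBall1Five :=
  loop5_of_fin' hexBall1Five hL fiveMarkedLoopLemmaFin_hexBall1Five

/-- … and unconditionally (the locality face holds for every domain, `loopLocal_holds`): the five-marked loop lemma on
`hexBall1Five` for ALL configurations `σ : Set (Site 2)`, by decision — an instance of, and independent from, the
interface-walk proof `fiveMarkedLoopLemma_holds`. [cite: KhristoforovSmirnov2021, §1.2 Lemma 2] -/
theorem fiveMarkedLoopLemma_hexBall1Five_decided : FiveMarkedLoopLemma hexBall1Five :=
  fiveMarkedLoopLemma_hexBall1Five_of_loopLocal (loopLocal_holds hexBall1Five)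

end Literature.Probability.Percolation.FivePoint.Rung

end
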